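import Literature.AlgebraicGeometry.ModuliOfAbelianVarieties.SiegelFamilyHumbertModularGroup
import Literature.AlgebraicGeometry.ModuliOfAbelianVarieties.SiegelFamilyHilbertModularGroup
import HarnessLib

/-!
# Runge's Lemma 4: the Humbert modular group of the normal form `(k, l, −1, 0, 0)` is generated by the Galois
# involution `σ_Gal` and the lift of the Hilbert modular group `SL(O ⊕ O^∨)` — in fact
# `Γ((k,l,−1,0,0)) = lift(SL(O ⊕ O^∨)) ∪ σ_Gal · lift(SL(O ⊕ O^∨))`

Layer `Literature/AlgebraicGeometry/ModuliOfAbelianVarieties`, namespace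
`Literature.AlgebraicGeometry.ModuliOfAbelianVarieties.SiegelModuli`; lane `lit-hodgefound` (Track 2 foundations
library, Layer A4), seat `lit-hodgefound-skel-4`, row **A4-71**, FILE 2 (three small definitions with bodies —
`permMatrix = (0 1; 1 0)`, `permSp = diag(P, P) ∈ Sp₄(ℝ)`, `omegaRep = diag(ᵗA(ω), A(ω))` — theorems otherwise; NO named
fact, NO sorry, net debt 0). Sequel of FILE 1 (`SiegelFamilyHumbertModularGroup`: `humbertModularGroup q = Γ(q)`,
`IsPrimitiveRel.gDHom_mem_humbertModularGroup_iff`, `modularEmbeddingLift_mem_humbertModularGroup`) and of row A4-70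
F3/F4 (`SiegelFamilyHumbertModularEquivariance`: `slPairSp = σ`, `rungeConj = (ᵗR 0; 0 R⁻¹)`, `modularEmbeddingLift`;
`SiegelFamilyHilbertModularGroup`: `hilbertModularPairGroup = SL(O ⊕ O^∨)`, `mem_range_gDHom_one_iff`), of row A4-64
(`SiegelFamilyHumbertModularEquivalence`: `swapSp l = diag(ᵗV, V)`, `V = (1 l; 0 −1)`, `modularEmbedding_swap_eq_smul`,
`smul_humbertLocus_humbertNormalForm_swap`), A4-65 F1 (`eq_humbertGram_add_smul_typeForm`, `spInv`) and A4-66/67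
(`rungeMatrix = R`, `dualRungeMatrix = S`, `regRep = A(·)`, `dualRungeMatrix_mul_regRep`,
`rungeMatrix_mul_transpose_regRep`), all BY NAME.

## Source, verbatim

B. Runge, Tohoku Math. J. 51 (1999), §4 p. 291 (held `paper:doi-10-2748-tmj-1178224764` p0009 L11–L21): "By taking the
quotient `Γ(F)\H(F)`, we get the standard model for Humbert surfaces. The Humbert modular group `Γ(F) = Γ(Δ)` is
described in the following lemma. LEMMA 4. For any order `O` in a real quadratic algebra `F` there exists a Rosati
equivariant embedding `ψ_O : M₂(F) → M₄(ℚ)` and an element `σ_Gal ∈ Γ₂ = Sp(4, ℤ)` of order two, such that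
`ψ_O⁻¹(Im(ψ_O) ∩ Γ₂) = Sl(2, O)` and `σ_Gal ψ_O(x) σ_Gal = ψ_O(x̄)`, where `x ↦ x̄` generates the Galois group
`Gal(F/ℚ)`. The Humbert modular group `Γ(F) = Γ(Δ)` is generated by `σ_Gal` and `ψ_O(Sl(2, O))`." (The two `4 × 4`
matrices of `ψ_O` and `σ_Gal` printed there are OCR-garbled in the held copy and are NOT transcribed; this file uses
the tree's `π[R]`-normalisation of rows A4-64/A4-70: the embedding is `g ↦ (ᵗR 0; 0 R⁻¹) σ(g) (ᵗR 0; 0 R⁻¹)⁻¹`, whose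
integral points are `SL(O ⊕ O^∨)` (row A4-70 F4) instead of Runge's `Sl(2, O)`-normalised `ψ_O`, and
`σ_Gal = swapSp l = diag(ᵗV, V)`, `V = (1 l; 0 −1) = R⁻¹ P R`, `P = (0 1; 1 0)`.)  §3 p. 287 (p0005):
"`Γ(L) = {σ ∈ Γ_g ; σL = Lσ}`".

## The argument (linear algebra; `q₀ = (k, l, −1, 0, 0)`, `E₁ = (0 1₂; −1₂ 0)`, `f₀ = E₁⁻¹ N(q₀) = diag(ᵗA(ω), A(ω))`)

For `γ = ᵗN ∈ G_1` (`N ∈ Sp₄(ℤ)`): `γ ∈ Γ(q₀) ⟺ q₀^N = ±q₀` (FILE 1) `⟺ ᵗN N(q₀) N = ±N(q₀) + cE₁`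
(`eq_humbertGram_add_smul_typeForm`) `⟺ N⁻¹ f₀ N = ±f₀ + c·1` — Runge's "`σL = Lσ`" for `L = ℚ(f₀)`; traces force
`c = 0` (sign `+`: `N` commutes with `f₀`) resp. `c = l = tr_{F/ℚ}(ω)` (sign `−`: `N⁻¹ f₀ N = l − f₀ = f̄₀`, the Galois
conjugate).  Over `ℝ`, `(ᵗR 0; 0 R⁻¹)⁻¹ ᵗf₀ (ᵗR 0; 0 R⁻¹) = diag(ρ₀, ρ₁, ρ₀, ρ₁)` (`ρ_s = σ_s(ω)`, the eigen-relations
`S A(ω) = diag(ρ) S`, `R ᵗA(ω) = diag(ρ) R` of rows A4-66/67); the centraliser of `diag(ρ₀, ρ₁, ρ₀, ρ₁)` (`ρ₀ ≠ ρ₁`) in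
`Sp₄(ℝ)` is `σ(SL₂(ℝ)²)` (all four blocks diagonal), and an element conjugating it to `l − diag = diag(ρ₁, ρ₀, ρ₁, ρ₀)`
is `diag(P, P)` times such; conjugating back, `γ = lift(g)` or `γ = σ_Gal · lift(g)`, and `g ∈ SL(O ⊕ O^∨)` because
`lift(g) ∈ G_1` (row A4-70 F4's definition of `hilbertModularPairGroup`).

## Contents (proved; no named fact)

* §1 `permMatrix`, `permSp`, `permSp_mul_slPairSp_mul_permSp` (`diag(P,P) σ(g) diag(P,P) = σ(g ∘ swap)`),
  `eq_slPairMatrix_of_commute_diagonal` / **`exists_eq_slPairSp_of_commute`** (the centraliser of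
  `diag(ρ₀, ρ₁, ρ₀, ρ₁)` in `Sp₄(ℝ)` is `σ(SL₂(ℝ)²)`), `exists_eq_permSp_mul_slPairSp_of_anticommute`.
* §2 `permMatrix_mul_rungeMatrix` (`P R = R V`), **`rungeConj_mul_permSp_mul_rungeConj_inv`** (`= swapSp l = σ_Gal`),
  `swapSp_mul_self`, `swapSp_mem_levelGD` (`σ_Gal ∈ Γ₂`), **`swapSp_mul_modularEmbeddingLift_mul_swapSp`**
  (`σ_Gal ψ(g) σ_Gal = ψ(ḡ)`: "`σ_Gal ψ_O(x) σ_Gal = ψ_O(x̄)`"), `swap_mem_hilbertModularPairGroup` (`SL(O ⊕ O^∨)` is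
  Galois-stable), **`swapSp_mem_humbertModularGroup`** (`σ_Gal ∈ Γ(Δ)`), `modularEmbeddingLift_mem_humbertModularGroup_of_mem`.
* §3 `omegaRep`, **`humbertGram_humbertNormalForm`** (`N(q₀) = E₁ f₀`), `trace_omegaRep` (`= 2l`),
  **`rungeConj_inv_mul_transpose_omegaRep_mul_rungeConj`** (`= diag(ρ₀, ρ₁, ρ₀, ρ₁)`).
* §4 **`exists_spInv_mul_omegaRep_mul_eq`** (`q₀^N = εq₀ ⟹ N⁻¹ f₀ N = εf₀ + c`), `omegaRep_mul_eq_of_humbertVectorConj_eq_self`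
  (`c = 0`), `omegaRep_mul_eq_of_humbertVectorConj_eq_neg` (`c = l`).
* §5 **`exists_eq_modularEmbeddingLift_of_humbertVectorConj_eq_self`**, **`exists_eq_swapSp_mul_modularEmbeddingLift_of_humbertVectorConj_eq_neg`**,
  **`mem_humbertModularGroup_humbertNormalForm_iff`** (RUNGE'S LEMMA 4 AS AN EQUALITY OF SETS:
  `γ ∈ Γ((k,l,−1,0,0)) ⟺ ∃ g ∈ SL(O ⊕ O^∨), γ = lift(g) ∨ γ = σ_Gal · lift(g)`),
  **`humbertModularGroup_humbertNormalForm_eq_closure`** (LEMMA 4 AS PRINTED: `Γ(Δ)` is generated by `σ_Gal` and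
  `lift(SL(O ⊕ O^∨))`), and the pull-back to `ℍ × ℍ`: **`exists_mem_hilbertModularPairGroup_of_mk_modularEmbedding_eq`**
  (for `τ` with relation lattice `ℤq₀` and `[π[R](τ)] = [π[R](τ′)]` in `𝒜₂`: `τ′ = g·τ` or `τ′ = g·τ^σ` with
  `g ∈ SL(O ⊕ O^∨)` — Elkies–Kumar's "the induced map on `(Γ ∪ Γσ)\ℍ²` is generically one to one").

## Scope

Runge's own `ψ_O` (normalised so that the integral points are `Sl(2, O)`) differs from the tree's lift by the twist
`(1 0; 0 σ(δ))` ("This embedding is obtained by extending the above embedding of `F` by `y ↦ σ(δ)y`", p. 291); only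
the `SL(O ⊕ O^∨)` form is formalised. The orbit-space statement for `(Γ ∪ Γσ)\ℍ²` is left to FILE 3.

## References

* [Runge1999EndomorphismRingsAbelianSurfaces] B. Runge, Tohoku Math. J. 51 (1999) 283–303, §3 p. 287, §4 p. 291 Lemma 4.
* [ElkiesKumar2014HilbertModularSurfaces] N. D. Elkies, A. Kumar, Algebra & Number Theory 8 (2014), §3, §4.
* [BirkenhakeWilhelm2003] Ch. Birkenhake, H. Wilhelm, Trans. AMS 355 (2003), §4 (7)–(9), Lemma 4.1, Prop. 4.5.
-/

noncomputable section

open Matrix Complex Module Function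
open scoped UpperHalfPlane

namespace Literature.AlgebraicGeometry.ModuliOfAbelianVarieties

namespace SiegelModuli

open Literature.NumberTheory.Automorphic (siegelUpperHalfSpace)
open Literature.NumberTheory.ModularForms.SiegelUpperHalfSpace
open Sum

/-! ## §1 `diag(P, P)` and the centraliser of `diag(ρ₀, ρ₁, ρ₀, ρ₁)` in `Sp₄(ℝ)` -/

section Perm

/-- The transposition matrix `P = (0 1; 1 0)`. [cite: Runge1999EndomorphismRingsAbelianSurfaces, §4 p. 291 (the Galois element `σ_Gal`)] -/
def permMatrix : Matrix (Fin 2) (Fin 2) ℝ := !![0, 1; 1, 0]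

/-- `P² = 1`. [cite: Runge1999EndomorphismRingsAbelianSurfaces, §4 p. 291] -/
theorem permMatrix_mul_self : permMatrix * permMatrix = 1 := by
  ext i j; fin_cases i <;> fin_cases j <;> simp [permMatrix, Matrix.mul_apply, Fin.sum_univ_two]

/-- `ᵗP = P`. [cite: Runge1999EndomorphismRingsAbelianSurfaces, §4 p. 291] -/
theorem transpose_permMatrix : permMatrixᵀ = permMatrix := by
  ext i j; fin_cases i <;> fin_cases j <;> simp [permMatrix]

/-- `P diag(d₀, d₁) P = diag(d₁, d₀)`. [cite: Runge1999EndomorphismRingsAbelianSurfaces, §4 p. 291] -/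
theorem permMatrix_mul_diagonal_mul_permMatrix (d : Fin 2 → ℝ) :
    permMatrix * diagonal d * permMatrix = diagonal fun s ↦ d (Equiv.swap (0 : Fin 2) 1 s) := by
  ext i j
  simp only [Matrix.mul_apply, Fin.sum_univ_two, Matrix.diagonal_apply, permMatrix]
  fin_cases i <;> fin_cases j <;> simp

/-- **`diag(P, P) ∈ Sp₄(ℝ)`** (the coordinate form of Runge's Galois element: it exchanges the two eigen-planes).
[cite: Runge1999EndomorphismRingsAbelianSurfaces, §4 p. 291] -/
def permSp : Matrix.symplecticGroup (Fin 2) ℝ :=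
  ⟨Matrix.fromBlocks permMatrix 0 0 permMatrix, by
    rw [SymplecticGroup.fromBlocks_mem_iff]
    refine ⟨by simp, by simp, ?_⟩
    rw [Matrix.transpose_zero, Matrix.zero_mul, sub_zero, transpose_permMatrix, permMatrix_mul_self]⟩

/-- The matrix of `permSp`. [cite: Runge1999EndomorphismRingsAbelianSurfaces, §4 p. 291] -/
@[simp] theorem coe_permSp :
    ((permSp : Matrix.symplecticGroup (Fin 2) ℝ) : Matrix (Fin 2 ⊕ Fin 2) (Fin 2 ⊕ Fin 2) ℝ) =
      Matrix.fromBlocks permMatrix 0 0 permMatrix := rfl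

/-- `diag(P, P)² = 1`. [cite: Runge1999EndomorphismRingsAbelianSurfaces, §4 p. 291 ("of order two")] -/
theorem permSp_mul_self : permSp * permSp = 1 := by
  apply Subtype.ext
  rw [Submonoid.coe_mul, coe_permSp, Matrix.fromBlocks_multiply, Submonoid.coe_one, ← Matrix.fromBlocks_one]
  simp [permMatrix_mul_self]

/-- `diag(P, P)⁻¹ = diag(P, P)`. [cite: Runge1999EndomorphismRingsAbelianSurfaces, §4 p. 291] -/
theorem permSp_inv : permSp⁻¹ = permSp :=
  inv_eq_of_mul_eq_one_right permSp_mul_self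

/-- **`diag(P, P) σ(g₀, g₁) diag(P, P) = σ(g₁, g₀)`**: conjugation by the coordinate Galois element exchanges the two
factors. [cite: Runge1999EndomorphismRingsAbelianSurfaces, §4 p. 291 ("`σ_Gal ψ_O(x) σ_Gal = ψ_O(x̄)`")] -/
theorem permSp_mul_slPairSp_mul_permSp (g : Fin 2 → Matrix.SpecialLinearGroup (Fin 2) ℝ) :
    permSp * slPairSp g * permSp = slPairSp fun s ↦ g (Equiv.swap (0 : Fin 2) 1 s) := by
  apply Subtype.ext
  rw [Submonoid.coe_mul, Submonoid.coe_mul, coe_permSp, coe_slPairSp, coe_slPairSp, slPairMatrix, slPairMatrix,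
    Matrix.fromBlocks_multiply, Matrix.fromBlocks_multiply]
  simp only [Matrix.mul_zero, Matrix.zero_mul, add_zero, zero_add, permMatrix_mul_diagonal_mul_permMatrix]

/-- **A real `4 × 4` matrix commuting with `diag(ρ₀, ρ₁, ρ₀, ρ₁)`, `ρ₀ ≠ ρ₁`, has its four blocks diagonal**: it is
`σ` of the pair of `2 × 2` matrices read off along the two eigen-planes.
[cite: Runge1999EndomorphismRingsAbelianSurfaces, §3 p. 287 ("`Γ(L) = {σ ∈ Γ_g ; σL = Lσ}`") and §4 p. 291] -/
theorem eq_slPairMatrix_of_commute_diagonal {ρ : Fin 2 → ℝ} (hρ : ρ 0 ≠ ρ 1)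
    {b : Matrix (Fin 2 ⊕ Fin 2) (Fin 2 ⊕ Fin 2) ℝ}
    (h : b * diagonal (Sum.elim ρ ρ) = diagonal (Sum.elim ρ ρ) * b) :
    b = slPairMatrix fun s ↦ !![b (inl s) (inl s), b (inl s) (inr s); b (inr s) (inl s), b (inr s) (inr s)] := by
  have hent : ∀ i j, b i j * Sum.elim ρ ρ j = Sum.elim ρ ρ i * b i j := fun i j ↦ by
    have e := congrFun (congrFun h i) j
    rwa [Matrix.mul_diagonal, Matrix.diagonal_mul] at e
  have hzero : ∀ i j, Sum.elim ρ ρ i ≠ Sum.elim ρ ρ j → b i j = 0 := fun i j hij ↦ by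
    have e := hent i j
    have e' : (Sum.elim ρ ρ j - Sum.elim ρ ρ i) * b i j = 0 := by linear_combination e
    exact (mul_eq_zero.1 e').resolve_left (sub_ne_zero.2 (Ne.symm hij))
  have hρ' : ρ 1 ≠ ρ 0 := Ne.symm hρ
  ext i j
  rcases i with i | i <;> rcases j with j | j <;> fin_cases i <;> fin_cases j <;>
    simp [slPairMatrix, Matrix.fromBlocks, diagonal, hzero, hρ, hρ']

/-- **The centraliser of `diag(ρ₀, ρ₁, ρ₀, ρ₁)` (`ρ₀ ≠ ρ₁`) in `Sp₄(ℝ)` is `σ(SL₂(ℝ) × SL₂(ℝ))`.**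
[cite: Runge1999EndomorphismRingsAbelianSurfaces, §3 p. 287 and §4 p. 291 (Lemma 4)] -/
theorem exists_eq_slPairSp_of_commute {ρ : Fin 2 → ℝ} (hρ : ρ 0 ≠ ρ 1) {b : Matrix.symplecticGroup (Fin 2) ℝ}
    (h : (b : Matrix (Fin 2 ⊕ Fin 2) (Fin 2 ⊕ Fin 2) ℝ) * diagonal (Sum.elim ρ ρ) =
      diagonal (Sum.elim ρ ρ) * (b : Matrix (Fin 2 ⊕ Fin 2) (Fin 2 ⊕ Fin 2) ℝ)) :
    ∃ g : Fin 2 → Matrix.SpecialLinearGroup (Fin 2) ℝ, b = slPairSp g := by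
  set B : Matrix (Fin 2 ⊕ Fin 2) (Fin 2 ⊕ Fin 2) ℝ := (b : Matrix (Fin 2 ⊕ Fin 2) (Fin 2 ⊕ Fin 2) ℝ) with hB
  have hb := eq_slPairMatrix_of_commute_diagonal hρ h
  -- the determinant condition from `ᵗA D − ᵗC B = 1`
  have hmem : slPairMatrix (fun s ↦ !![B (inl s) (inl s), B (inl s) (inr s); B (inr s) (inl s), B (inr s) (inr s)]) ∈
      Matrix.symplecticGroup (Fin 2) ℝ := by
    rw [← hb]; exact b.2
  rw [slPairMatrix, SymplecticGroup.fromBlocks_mem_iff] at hmem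
  obtain ⟨-, -, h3⟩ := hmem
  have hdet : ∀ s, B (inl s) (inl s) * B (inr s) (inr s) - B (inr s) (inl s) * B (inl s) (inr s) = 1 := fun s ↦ by
    have e := congrFun (congrFun h3 s) s
    simp [Matrix.sub_apply] at e
    linear_combination e
  refine ⟨fun s ↦ ⟨!![B (inl s) (inl s), B (inl s) (inr s); B (inr s) (inl s), B (inr s) (inr s)], ?_⟩, ?_⟩
  · rw [Matrix.det_fin_two_of]
    linear_combination hdet s
  · exact Subtype.ext hb

/-- **… and an element of `Sp₄(ℝ)` conjugating `diag(ρ₀, ρ₁, ρ₀, ρ₁)` to `diag(ρ₁, ρ₀, ρ₁, ρ₀)` lies in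
`diag(P, P) · σ(SL₂(ℝ)²)`** (here phrased: `b D + D b = (ρ₀ + ρ₁) b`). [cite: Runge1999EndomorphismRingsAbelianSurfaces, §4 p. 291 (Lemma 4, the element `σ_Gal`)] -/
theorem exists_eq_permSp_mul_slPairSp_of_anticommute {ρ : Fin 2 → ℝ} (hρ : ρ 0 ≠ ρ 1)
    {b : Matrix.symplecticGroup (Fin 2) ℝ}
    (h : (b : Matrix (Fin 2 ⊕ Fin 2) (Fin 2 ⊕ Fin 2) ℝ) * diagonal (Sum.elim ρ ρ) +
      diagonal (Sum.elim ρ ρ) * (b : Matrix (Fin 2 ⊕ Fin 2) (Fin 2 ⊕ Fin 2) ℝ) =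
        (ρ 0 + ρ 1) • (b : Matrix (Fin 2 ⊕ Fin 2) (Fin 2 ⊕ Fin 2) ℝ)) :
    ∃ g : Fin 2 → Matrix.SpecialLinearGroup (Fin 2) ℝ, b = permSp * slPairSp g := by
  set D : Matrix (Fin 2 ⊕ Fin 2) (Fin 2 ⊕ Fin 2) ℝ := diagonal (Sum.elim ρ ρ) with hD
  -- `diag(P,P) D diag(P,P) = (ρ₀ + ρ₁) − D`
  have hPD : ((permSp : Matrix.symplecticGroup (Fin 2) ℝ) : Matrix (Fin 2 ⊕ Fin 2) (Fin 2 ⊕ Fin 2) ℝ) * D =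
      ((ρ 0 + ρ 1) • (1 : Matrix (Fin 2 ⊕ Fin 2) (Fin 2 ⊕ Fin 2) ℝ) - D) *
        ((permSp : Matrix.symplecticGroup (Fin 2) ℝ) : Matrix (Fin 2 ⊕ Fin 2) (Fin 2 ⊕ Fin 2) ℝ) := by
    rw [coe_permSp, hD]
    ext i j
    rcases i with i | i <;> rcases j with j | j <;> fin_cases i <;> fin_cases j <;>
      simp [Matrix.fromBlocks, permMatrix, diagonal, Matrix.mul_apply, Fintype.sum_sum_type, Fin.sum_univ_two,
        Matrix.sub_apply, Matrix.smul_apply]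
  have hcomm : ((permSp * b : Matrix.symplecticGroup (Fin 2) ℝ) : Matrix (Fin 2 ⊕ Fin 2) (Fin 2 ⊕ Fin 2) ℝ) * D =
      D * ((permSp * b : Matrix.symplecticGroup (Fin 2) ℝ) : Matrix (Fin 2 ⊕ Fin 2) (Fin 2 ⊕ Fin 2) ℝ) := by
    have hb : (b : Matrix (Fin 2 ⊕ Fin 2) (Fin 2 ⊕ Fin 2) ℝ) * D =
        (ρ 0 + ρ 1) • (b : Matrix (Fin 2 ⊕ Fin 2) (Fin 2 ⊕ Fin 2) ℝ) - D * (b : Matrix _ _ ℝ) := eq_sub_of_add_eq h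
    rw [Submonoid.coe_mul]
    calc ((permSp : Matrix.symplecticGroup (Fin 2) ℝ) : Matrix _ _ ℝ) * (b : Matrix _ _ ℝ) * D
        = ((permSp : Matrix.symplecticGroup (Fin 2) ℝ) : Matrix _ _ ℝ) * ((b : Matrix _ _ ℝ) * D) := Matrix.mul_assoc _ _ _
      _ = ((permSp : Matrix.symplecticGroup (Fin 2) ℝ) : Matrix _ _ ℝ) *
            ((ρ 0 + ρ 1) • (b : Matrix _ _ ℝ) - D * (b : Matrix _ _ ℝ)) := by
          rw [hb]
      _ = (ρ 0 + ρ 1) • (((permSp : Matrix.symplecticGroup (Fin 2) ℝ) : Matrix _ _ ℝ) * (b : Matrix _ _ ℝ)) -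
            ((permSp : Matrix.symplecticGroup (Fin 2) ℝ) : Matrix _ _ ℝ) * D * (b : Matrix _ _ ℝ) := by
          rw [Matrix.mul_sub, Matrix.mul_smul, Matrix.mul_assoc]
      _ = (ρ 0 + ρ 1) • (((permSp : Matrix.symplecticGroup (Fin 2) ℝ) : Matrix _ _ ℝ) * (b : Matrix _ _ ℝ)) -
            ((ρ 0 + ρ 1) • (1 : Matrix (Fin 2 ⊕ Fin 2) (Fin 2 ⊕ Fin 2) ℝ) - D) *
              ((permSp : Matrix.symplecticGroup (Fin 2) ℝ) : Matrix _ _ ℝ) * (b : Matrix _ _ ℝ) := by rw [hPD]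
      _ = D * (((permSp : Matrix.symplecticGroup (Fin 2) ℝ) : Matrix _ _ ℝ) * (b : Matrix _ _ ℝ)) := by
          rw [Matrix.sub_mul, Matrix.sub_mul, Matrix.smul_mul, Matrix.one_mul, Matrix.smul_mul, Matrix.mul_assoc]
          abel
  obtain ⟨g, hg⟩ := exists_eq_slPairSp_of_commute hρ hcomm
  refine ⟨g, ?_⟩
  rw [← hg, ← mul_assoc, permSp_mul_self, one_mul]

end Perm

/-! ## §2 `σ_Gal = (ᵗR 0; 0 R⁻¹) diag(P, P) (ᵗR 0; 0 R⁻¹)⁻¹ = swapSp l ∈ Γ((k,l,−1,0,0))` and `σ_Gal ψ(g) σ_Gal = ψ(ḡ)` -/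

section Galois

variable {k l : ℤ}

/-- `P R = R V`, `V = (1 l; 0 −1)`: exchanging the two real embeddings is the change of basis `(1, ω) ↦ (1, l − ω) = (1, ω̄)`
(`σ₂(ω) = l − σ₁(ω)`). [cite: Runge1999EndomorphismRingsAbelianSurfaces, §4 p. 291 ("`ω̄ = l − ω`")] -/
theorem permMatrix_mul_rungeMatrix (k l : ℤ) :
    permMatrix * rungeMatrix k l = rungeMatrix k l * !![(1 : ℝ), l; 0, -1] := by
  have hs := quadRoot_add k l
  ext i j
  fin_cases i <;> fin_cases j <;> simp [permMatrix, rungeMatrix, Matrix.mul_apply, Fin.sum_univ_two] <;> linarith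

/-- `V² = 1` for `V = (1 l; 0 −1)` (integral). [cite: Runge1999EndomorphismRingsAbelianSurfaces, §4 p. 291 ("of order two")] -/
theorem galoisMatrix_mul_self (l : ℤ) : !![(1 : ℤ), l; 0, -1] * !![(1 : ℤ), l; 0, -1] = 1 := by
  ext i j; fin_cases i <;> fin_cases j <;> simp [Matrix.mul_apply, Fin.sum_univ_two]

/-- **`(ᵗR 0; 0 R⁻¹) diag(P, P) (ᵗR 0; 0 R⁻¹)⁻¹ = diag(ᵗV, V) = swapSp l`** (`R⁻¹ P R = V`): the coordinate Galois element
becomes Runge's INTEGRAL `σ_Gal` on Runge's model. [cite: Runge1999EndomorphismRingsAbelianSurfaces, §4 p. 291 (Lemma 4, `σ_Gal ∈ Γ₂`)] -/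
theorem rungeConj_mul_permSp_mul_rungeConj_inv (hΔ : 0 < quadDisc k l) :
    rungeConj k l hΔ * permSp * (rungeConj k l hΔ)⁻¹ = swapSp l := by
  have hSR : (dualRungeMatrix k l)ᵀ * rungeMatrix k l = 1 := by
    have h := congrArg Matrix.transpose (transpose_rungeMatrix_mul_dualRungeMatrix k l hΔ)
    rwa [Matrix.transpose_mul, Matrix.transpose_transpose, Matrix.transpose_one] at h
  have hV : (!![(1 : ℤ), l; 0, -1]).map (Int.cast : ℤ → ℝ) = !![(1 : ℝ), l; 0, -1] := by
    ext i j; fin_cases i <;> fin_cases j <;> simp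
  have h22 : (dualRungeMatrix k l)ᵀ * permMatrix * rungeMatrix k l = !![(1 : ℝ), l; 0, -1] := by
    rw [Matrix.mul_assoc, permMatrix_mul_rungeMatrix, ← Matrix.mul_assoc, hSR, Matrix.one_mul]
  have h11 : (rungeMatrix k l)ᵀ * permMatrix * dualRungeMatrix k l = (!![(1 : ℝ), l; 0, -1])ᵀ := by
    rw [← h22, Matrix.transpose_mul, Matrix.transpose_mul, Matrix.transpose_transpose, transpose_permMatrix,
      Matrix.mul_assoc]
  apply Subtype.ext
  rw [Submonoid.coe_mul, Submonoid.coe_mul, coe_rungeConj, coe_permSp, coe_rungeConj_inv, Matrix.fromBlocks_multiply,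
    Matrix.fromBlocks_multiply, swapSp, coe_blockDiagSp, hV]
  simp only [Matrix.mul_zero, Matrix.zero_mul, add_zero, zero_add]
  rw [h11, h22]

/-- `σ_Gal² = 1`. [cite: Runge1999EndomorphismRingsAbelianSurfaces, §4 p. 291 ("of order two")] -/
theorem swapSp_mul_self (l : ℤ) : swapSp l * swapSp l = 1 := by
  have hV : (!![(1 : ℤ), l; 0, -1]).map (Int.cast : ℤ → ℝ) * (!![(1 : ℤ), l; 0, -1]).map (Int.cast : ℤ → ℝ) = 1 := by
    ext i j; fin_cases i <;> fin_cases j <;> simp [Matrix.mul_apply, Fin.sum_univ_two]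
  have hVt : ((!![(1 : ℤ), l; 0, -1]).map (Int.cast : ℤ → ℝ))ᵀ * ((!![(1 : ℤ), l; 0, -1]).map (Int.cast : ℤ → ℝ))ᵀ = 1 := by
    rw [← Matrix.transpose_mul, hV, Matrix.transpose_one]
  apply Subtype.ext
  rw [Submonoid.coe_mul, swapSp, coe_blockDiagSp, Matrix.fromBlocks_multiply, Submonoid.coe_one, ← Matrix.fromBlocks_one]
  simp [hV, hVt]

/-- `σ_Gal⁻¹ = σ_Gal`. [cite: Runge1999EndomorphismRingsAbelianSurfaces, §4 p. 291] -/
theorem swapSp_inv (l : ℤ) : (swapSp l)⁻¹ = swapSp l :=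
  inv_eq_of_mul_eq_one_right (swapSp_mul_self l)

/-- **`σ_Gal ∈ Γ₂ = G_1`**: it is the image of the integral symplectic matrix `diag(V, ᵗV)`.
[cite: Runge1999EndomorphismRingsAbelianSurfaces, §4 p. 291 ("`σ_Gal ∈ Γ₂ = Sp(4, ℤ)`")] -/
theorem swapSp_mem_levelGD (l : ℤ) : swapSp l ∈ levelGD (fun _ : Fin 2 ↦ (1 : ℕ)) 1 principalType_pos := by
  rw [siegelThreefold.mem_levelGD_one_iff]
  refine ⟨(spUnit (blockDiag !![(1 : ℤ), l; 0, -1] !![(1 : ℤ), l; 0, -1])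
    (transpose_blockDiag_mul_typeForm_mul (galoisMatrix_mul_self l)))⁻¹, ?_⟩
  rw [map_inv, gDHom_spUnit, inv_inv]
  rfl

/-- **"`σ_Gal ψ_O(x) σ_Gal = ψ_O(x̄)`": conjugating the lift of `g = (g₀, g₁)` by `σ_Gal` gives the lift of the Galois
conjugate pair `(g₁, g₀)`.** [cite: Runge1999EndomorphismRingsAbelianSurfaces, §4 p. 291 (Lemma 4)] -/
theorem swapSp_mul_modularEmbeddingLift_mul_swapSp (hΔ : 0 < quadDisc k l)
    (g : Fin 2 → Matrix.SpecialLinearGroup (Fin 2) ℝ) :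
    swapSp l * modularEmbeddingLift k l hΔ g * swapSp l =
      modularEmbeddingLift k l hΔ fun s ↦ g (Equiv.swap (0 : Fin 2) 1 s) := by
  rw [← rungeConj_mul_permSp_mul_rungeConj_inv hΔ, modularEmbeddingLift, modularEmbeddingLift,
    ← permSp_mul_slPairSp_mul_permSp]
  group

/-- **`SL(O ⊕ O^∨)` is stable under the Galois conjugation `(g₀, g₁) ↦ (g₁, g₀)`** (its lift is normalised by
`σ_Gal ∈ Γ₂`). [cite: Runge1999EndomorphismRingsAbelianSurfaces, §4 p. 291 (Lemma 4)] [cite: ElkiesKumar2014HilbertModularSurfaces, §4 ("`(Γ ∪ Γσ)\ℍ²`")] -/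
theorem swap_mem_hilbertModularPairGroup (hΔ : 0 < quadDisc k l) {g : Fin 2 → Matrix.SpecialLinearGroup (Fin 2) ℝ}
    (hg : g ∈ hilbertModularPairGroup k l hΔ) :
    (fun s ↦ g (Equiv.swap (0 : Fin 2) 1 s)) ∈ hilbertModularPairGroup k l hΔ := by
  rw [mem_hilbertModularPairGroup_iff_mem_range] at hg ⊢
  rw [← swapSp_mul_modularEmbeddingLift_mul_swapSp hΔ]
  have hs : swapSp l ∈ (gDHom (fun _ : Fin 2 ↦ 1) principalType_pos).range :=
    (siegelThreefold.mem_levelGD_one_iff principalType_pos).1 (swapSp_mem_levelGD l)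
  exact mul_mem (mul_mem hs hg) hs

/-- **`σ_Gal ∈ Γ(Δ)`**: the Galois element lies in the Humbert modular group of the normal form `(k, l, −1, 0, 0)`
(it preserves `H_{(k,l,−1,0,0)} = π[R](ℍ × ℍ)`, row A4-64 `smul_humbertLocus_humbertNormalForm_swap`).
[cite: Runge1999EndomorphismRingsAbelianSurfaces, §4 p. 291 (Lemma 4)] -/
theorem swapSp_mem_humbertModularGroup (hΔ : 0 < quadDisc k l) :
    swapSp l ∈ humbertModularGroup (humbertNormalForm k l) := by
  have himg := smul_humbertLocus_humbertNormalForm_swap hΔ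
  refine mem_humbertModularGroup_iff.2 ⟨swapSp_mem_levelGD l, fun Z ↦ ⟨fun h ↦ ?_, fun h ↦ ?_⟩⟩
  · have h2 : swapSp l • (swapSp l • Z) ∈ humbertLocus (fun i ↦ (humbertNormalForm k l i : ℂ)) := by
      rw [← himg]; exact ⟨_, h, rfl⟩
    rwa [smul_smul, swapSp_mul_self, one_smul] at h2
  · rw [← himg]; exact ⟨Z, h, rfl⟩

/-- **`lift(SL(O ⊕ O^∨)) ≤ Γ(Δ)`** (FILE 1 `modularEmbeddingLift_mem_humbertModularGroup` with row A4-70 F4's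
definition of `SL(O ⊕ O^∨)` as the pull-back of `G_1`): the containment `ψ_O(Sl(2, O)) ⊆ Γ(Δ)` of Lemma 4.
[cite: Runge1999EndomorphismRingsAbelianSurfaces, §4 p. 291 (Lemma 4)] -/
theorem modularEmbeddingLift_mem_humbertModularGroup_of_mem (hΔ : 0 < quadDisc k l)
    {g : Fin 2 → Matrix.SpecialLinearGroup (Fin 2) ℝ} (hg : g ∈ hilbertModularPairGroup k l hΔ) :
    modularEmbeddingLift k l hΔ g ∈ humbertModularGroup (humbertNormalForm k l) :=
  modularEmbeddingLift_mem_humbertModularGroup hΔ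
    ((siegelThreefold.mem_levelGD_one_iff principalType_pos).2 ((mem_hilbertModularPairGroup_iff_mem_range hΔ g).1 hg))

end Galois

/-! ## §3 The symmetric endomorphism `f₀ = E₁⁻¹ N(q₀) = diag(ᵗA(ω), A(ω))` of the normal form and its diagonalisation -/

section Omega

variable (k l : ℤ)

/-- **`f₀ = diag(ᵗA(ω), A(ω))`, `A(ω) = (0 1; k l)`** — the rational representation (tree convention) of the symmetric
endomorphism whose singular relation is the normal form `q₀ = (k, l, −1, 0, 0)`: `N(q₀) = E₁ f₀`
(`humbertGram_humbertNormalForm`; B–W Lemma 4.1 `ρ_r(f) = (A B; C ᵗA)` with `B = C = 0`).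
[cite: BirkenhakeWilhelm2003, §4 Lemma 4.1 and eq. (8)–(9) (p. 1827)] [cite: Runge1999EndomorphismRingsAbelianSurfaces, §4 p. 290 ("twice the regular representation")] -/
def omegaRep : Matrix (Fin 2 ⊕ Fin 2) (Fin 2 ⊕ Fin 2) ℤ :=
  Matrix.fromBlocks (regRep k l QuadraticAlgebra.omega)ᵀ 0 0 (regRep k l QuadraticAlgebra.omega)

/-- **`N(q₀) = E₁ f₀`** for `q₀ = (k, l, −1, 0, 0)`. [cite: BirkenhakeWilhelm2003, §4 Lemma 4.1 and eq. (8)–(9) (p. 1827)] -/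
theorem humbertGram_humbertNormalForm :
    humbertGram (humbertNormalForm k l) = typeForm (fun _ : Fin 2 ↦ 1) * omegaRep k l := by
  rw [omegaRep, regRep_omega, typeForm_one_eq_neg_J, Matrix.J, humbertGram, humbertNormalForm]
  ext i j
  rcases i with i | i <;> rcases j with j | j <;> fin_cases i <;> fin_cases j <;>
    simp [Matrix.fromBlocks, Matrix.mul_apply, Fintype.sum_sum_type, Fin.sum_univ_two]

/-- `tr f₀ = 2l = 2 tr_{F/ℚ}(ω)`. [cite: Runge1999EndomorphismRingsAbelianSurfaces, §4 p. 290 ("`t(M) = Tr(A)`")] -/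
theorem trace_omegaRep : (omegaRep k l).trace = 2 * l := by
  simp [omegaRep, Matrix.trace, Matrix.diag, Fintype.sum_sum_type, Fin.sum_univ_two, regRep_omega]
  ring

variable {k l}

/-- **`(ᵗR 0; 0 R⁻¹)⁻¹ ᵗf₀ (ᵗR 0; 0 R⁻¹) = diag(ρ₀, ρ₁, ρ₀, ρ₁)`**, `ρ_s = σ_s(ω)`: Runge's conjugation diagonalises the
real multiplication (`S A(ω) = diag(ρ) S`, `R ᵗA(ω) = diag(ρ) R`, rows A4-66/67).
[cite: Runge1999EndomorphismRingsAbelianSurfaces, §4 pp. 290–291 ("`(A(ω))(π[R]) = … (ᵗRπR)(R⁻¹σ(ω)R)`")] -/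
theorem rungeConj_inv_mul_transpose_omegaRep_mul_rungeConj (hΔ : 0 < quadDisc k l) :
    (((rungeConj k l hΔ)⁻¹ : Matrix.symplecticGroup (Fin 2) ℝ) : Matrix (Fin 2 ⊕ Fin 2) (Fin 2 ⊕ Fin 2) ℝ) *
        ((omegaRep k l).map (Int.cast : ℤ → ℝ))ᵀ *
        ((rungeConj k l hΔ : Matrix.symplecticGroup (Fin 2) ℝ) : Matrix (Fin 2 ⊕ Fin 2) (Fin 2 ⊕ Fin 2) ℝ) =
      diagonal (Sum.elim (quadRoot k l) (quadRoot k l)) := by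
  have hρ : (fun i ↦ realEmb hΔ.le i QuadraticAlgebra.omega) = quadRoot k l := funext fun i ↦ realEmb_omega hΔ.le i
  have hSB : dualRungeMatrix k l * (regRep k l QuadraticAlgebra.omega).map (Int.cast : ℤ → ℝ) =
      diagonal (quadRoot k l) * dualRungeMatrix k l := by
    rw [dualRungeMatrix_mul_regRep hΔ, hρ]
  have hRB : rungeMatrix k l * ((regRep k l QuadraticAlgebra.omega).map (Int.cast : ℤ → ℝ))ᵀ =
      diagonal (quadRoot k l) * rungeMatrix k l := by
    rw [rungeMatrix_mul_transpose_regRep hΔ.le, hρ]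
  have hSR : dualRungeMatrix k l * (rungeMatrix k l)ᵀ = 1 := dualRungeMatrix_mul_transpose_rungeMatrix k l hΔ
  have hRS : rungeMatrix k l * (dualRungeMatrix k l)ᵀ = 1 := by
    have h := congrArg Matrix.transpose hSR
    rwa [Matrix.transpose_mul, Matrix.transpose_transpose, Matrix.transpose_one] at h
  have hT : ((omegaRep k l).map (Int.cast : ℤ → ℝ))ᵀ =
      Matrix.fromBlocks ((regRep k l QuadraticAlgebra.omega).map (Int.cast : ℤ → ℝ)) 0 0
        (((regRep k l QuadraticAlgebra.omega).map (Int.cast : ℤ → ℝ))ᵀ) := by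
    have e : (((regRep k l QuadraticAlgebra.omega)ᵀ).map (Int.cast : ℤ → ℝ))ᵀ =
        (regRep k l QuadraticAlgebra.omega).map (Int.cast : ℤ → ℝ) := by
      ext i j; simp
    rw [omegaRep, Matrix.fromBlocks_map, Matrix.fromBlocks_transpose, e]
    simp
  have h1 : dualRungeMatrix k l * (regRep k l QuadraticAlgebra.omega).map (Int.cast : ℤ → ℝ) * (rungeMatrix k l)ᵀ =
      diagonal (quadRoot k l) := by
    rw [hSB, Matrix.mul_assoc, hSR, Matrix.mul_one]
  have h2 : rungeMatrix k l * ((regRep k l QuadraticAlgebra.omega).map (Int.cast : ℤ → ℝ))ᵀ * (dualRungeMatrix k l)ᵀ =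
      diagonal (quadRoot k l) := by
    rw [hRB, Matrix.mul_assoc, hRS, Matrix.mul_one]
  rw [coe_rungeConj_inv, coe_rungeConj, hT, Matrix.fromBlocks_multiply, Matrix.fromBlocks_multiply,
    ← Matrix.fromBlocks_diagonal]
  simp only [Matrix.mul_zero, Matrix.zero_mul, add_zero, zero_add]
  rw [h1, h2]

end Omega

/-! ## §4 `q₀^N = εq₀ ⟹ N⁻¹ f₀ N = εf₀ + c`, and the trace fixes `c` -/

section Core

variable {k l : ℤ}

/-- `ᵗN E₁ = E₁ N⁻¹` for `N ∈ Sp₄(ℤ)` (`N⁻¹ = −E₁ ᵗN E₁`, `E₁² = −1`). [cite: Lange2023AbelianVarietiesComplex, §8.2 (8.5)] -/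
theorem transpose_mul_typeForm_eq_typeForm_mul_spInv (N : Matrix (Fin 2 ⊕ Fin 2) (Fin 2 ⊕ Fin 2) ℤ) :
    Nᵀ * typeForm (fun _ : Fin 2 ↦ 1) = typeForm (fun _ : Fin 2 ↦ 1) * spInv N := by
  rw [spInv, Matrix.mul_neg, ← Matrix.mul_assoc, ← Matrix.mul_assoc, typeForm_one_mul_self]
  simp

/-- **`q₀^N = εq₀` forces `N⁻¹ f₀ N = εf₀ + c·1` for an integer `c`** (the `E₁`-component invisible to the relation,
`eq_humbertGram_add_smul_typeForm`): Runge's "`σL = Lσ`" for `L = ℚ(f₀) = ℚ + ℚf₀`.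
[cite: Runge1999EndomorphismRingsAbelianSurfaces, §3 p. 287 ("`Γ(L) = {σ ∈ Γ_g ; σL = Lσ}`")] [cite: BirkenhakeWilhelm2003, §4 eq. (7)–(9) (p. 1827)] -/
theorem exists_spInv_mul_omegaRep_mul_eq {N : Matrix (Fin 2 ⊕ Fin 2) (Fin 2 ⊕ Fin 2) ℤ} {ε : ℤ}
    (h : humbertVectorConj N (humbertNormalForm k l) = ε • humbertNormalForm k l) :
    ∃ c : ℤ, spInv N * omegaRep k l * N = ε • omegaRep k l + c • (1 : Matrix (Fin 2 ⊕ Fin 2) (Fin 2 ⊕ Fin 2) ℤ) := by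
  set X : Matrix (Fin 2 ⊕ Fin 2) (Fin 2 ⊕ Fin 2) ℤ := Nᵀ * humbertGram (humbertNormalForm k l) * N with hX
  have hXt : Xᵀ = -X := by
    rw [hX, Matrix.transpose_mul, Matrix.transpose_mul, Matrix.transpose_transpose, humbertGram_transpose,
      Matrix.neg_mul, Matrix.mul_neg, Matrix.mul_assoc]
  have hdec := eq_humbertGram_add_smul_typeForm hXt
  have hq : humbertVectorOfGram X = ε • humbertNormalForm k l := h
  rw [hq, humbertGram_smul, humbertGram_humbertNormalForm] at hdec
  refine ⟨X (inl 0) (inr 0), ?_⟩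
  set c : ℤ := X (inl 0) (inr 0)
  -- `X = E₁ (N⁻¹ f₀ N)` and `X = E₁ (ε f₀ + c)`; cancel `E₁`
  have h1 : X = typeForm (fun _ : Fin 2 ↦ 1) * (spInv N * omegaRep k l * N) := by
    rw [hX, humbertGram_humbertNormalForm]
    calc Nᵀ * (typeForm (fun _ : Fin 2 ↦ 1) * omegaRep k l) * N
        = (Nᵀ * typeForm (fun _ : Fin 2 ↦ 1)) * omegaRep k l * N := by simp only [Matrix.mul_assoc]
      _ = typeForm (fun _ : Fin 2 ↦ 1) * (spInv N * omegaRep k l * N) := by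
          rw [transpose_mul_typeForm_eq_typeForm_mul_spInv]; simp only [Matrix.mul_assoc]
  have h2 : X = typeForm (fun _ : Fin 2 ↦ 1) * (ε • omegaRep k l + c • (1 : Matrix (Fin 2 ⊕ Fin 2) (Fin 2 ⊕ Fin 2) ℤ)) := by
    rw [Matrix.mul_add, Matrix.mul_smul, Matrix.mul_smul, Matrix.mul_one]
    exact hdec
  have cancel : ∀ Y Y' : Matrix (Fin 2 ⊕ Fin 2) (Fin 2 ⊕ Fin 2) ℤ,
      typeForm (fun _ : Fin 2 ↦ 1) * Y = typeForm (fun _ : Fin 2 ↦ 1) * Y' → Y = Y' := fun Y Y' e ↦ by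
    have e2 := congrArg (fun M ↦ typeForm (fun _ : Fin 2 ↦ 1) * M) e
    simp only [← Matrix.mul_assoc, typeForm_one_mul_self, Matrix.neg_mul, Matrix.one_mul, neg_inj] at e2
    exact e2
  exact cancel _ _ (h1.symm.trans h2)

/-- The trace of `N⁻¹ f₀ N` is the trace of `f₀`. [cite: Runge1999EndomorphismRingsAbelianSurfaces, §4 p. 290 ("Conjugation preserves the minimal equation")] -/
theorem trace_spInv_mul_mul {N : Matrix (Fin 2 ⊕ Fin 2) (Fin 2 ⊕ Fin 2) ℤ}
    (hN : Nᵀ * typeForm (fun _ : Fin 2 ↦ 1) * N = typeForm fun _ : Fin 2 ↦ 1)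
    (f : Matrix (Fin 2 ⊕ Fin 2) (Fin 2 ⊕ Fin 2) ℤ) : (spInv N * f * N).trace = f.trace := by
  rw [Matrix.mul_assoc, Matrix.trace_mul_comm, Matrix.mul_assoc, mul_spInv hN, Matrix.mul_one]

/-- **Sign `+`: `q₀^N = q₀` forces `c = 0`, i.e. `N` COMMUTES with `f₀`** (`tr f₀ = tr f₀ + 4c`).
[cite: Runge1999EndomorphismRingsAbelianSurfaces, §3 p. 287 and §4 p. 291 (Lemma 4)] -/
theorem omegaRep_mul_eq_of_humbertVectorConj_eq_self {N : Matrix (Fin 2 ⊕ Fin 2) (Fin 2 ⊕ Fin 2) ℤ}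
    (hN : Nᵀ * typeForm (fun _ : Fin 2 ↦ 1) * N = typeForm fun _ : Fin 2 ↦ 1)
    (h : humbertVectorConj N (humbertNormalForm k l) = humbertNormalForm k l) :
    omegaRep k l * N = N * omegaRep k l := by
  obtain ⟨c, hc⟩ := exists_spInv_mul_omegaRep_mul_eq (k := k) (l := l) (ε := 1) (by rw [one_smul]; exact h)
  have htr := congrArg Matrix.trace hc
  rw [trace_spInv_mul_mul hN, one_smul, Matrix.trace_add, Matrix.trace_smul, Matrix.trace_one, Fintype.card_sum,
    Fintype.card_fin, smul_eq_mul] at htr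
  have hc0 : c = 0 := by
    push_cast at htr; linarith
  rw [hc0, zero_smul, add_zero, one_smul] at hc
  have e : N * (spInv N * omegaRep k l * N) = N * omegaRep k l := by rw [hc]
  rw [← Matrix.mul_assoc, ← Matrix.mul_assoc, mul_spInv hN, Matrix.one_mul] at e
  exact e

/-- **Sign `−`: `q₀^N = −q₀` forces `c = l`, i.e. `N⁻¹ f₀ N = l − f₀ = f̄₀`** — `N` conjugates the real multiplication to
its Galois conjugate (`f₀ N + N f₀ = l N`). [cite: Runge1999EndomorphismRingsAbelianSurfaces, §4 p. 291 (Lemma 4, "`σ_Gal ψ_O(x) σ_Gal = ψ_O(x̄)`")] -/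
theorem omegaRep_mul_eq_of_humbertVectorConj_eq_neg {N : Matrix (Fin 2 ⊕ Fin 2) (Fin 2 ⊕ Fin 2) ℤ}
    (hN : Nᵀ * typeForm (fun _ : Fin 2 ↦ 1) * N = typeForm fun _ : Fin 2 ↦ 1)
    (h : humbertVectorConj N (humbertNormalForm k l) = -humbertNormalForm k l) :
    omegaRep k l * N = l • N - N * omegaRep k l := by
  obtain ⟨c, hc⟩ := exists_spInv_mul_omegaRep_mul_eq (k := k) (l := l) (ε := -1) (by rw [neg_one_smul]; exact h)
  have htr := congrArg Matrix.trace hc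
  rw [trace_spInv_mul_mul hN, Matrix.trace_add, Matrix.trace_smul, Matrix.trace_smul, Matrix.trace_one,
    Fintype.card_sum, Fintype.card_fin, smul_eq_mul, smul_eq_mul, trace_omegaRep] at htr
  have hcl : c = l := by
    push_cast at htr; linarith
  rw [hcl] at hc
  have e : N * (spInv N * omegaRep k l * N) =
      N * ((-1 : ℤ) • omegaRep k l + l • (1 : Matrix (Fin 2 ⊕ Fin 2) (Fin 2 ⊕ Fin 2) ℤ)) := by rw [hc]
  rw [← Matrix.mul_assoc, ← Matrix.mul_assoc, mul_spInv hN, Matrix.one_mul, Matrix.mul_add, Matrix.mul_smul,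
    Matrix.mul_smul, Matrix.mul_one, neg_one_smul] at e
  rw [e]; abel

end Core

/-! ## §5 Lemma 4: `Γ((k,l,−1,0,0)) = lift(SL(O ⊕ O^∨)) ∪ σ_Gal · lift(SL(O ⊕ O^∨))` -/

section Lemma4

variable {k l : ℤ}

/-- Casting a product of integer matrices. [folklore] -/
private theorem map_intCast_mul (A B : Matrix (Fin 2 ⊕ Fin 2) (Fin 2 ⊕ Fin 2) ℤ) :
    (A * B).map (Int.cast : ℤ → ℝ) = A.map (Int.cast : ℤ → ℝ) * B.map (Int.cast : ℤ → ℝ) :=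
  Matrix.map_mul (f := Int.castRingHom ℝ)

/-- Casting a difference of integer matrices. [folklore] -/
private theorem map_intCast_sub (A B : Matrix (Fin 2 ⊕ Fin 2) (Fin 2 ⊕ Fin 2) ℤ) :
    (A - B).map (Int.cast : ℤ → ℝ) = A.map (Int.cast : ℤ → ℝ) - B.map (Int.cast : ℤ → ℝ) := by
  ext i j; simp

/-- Casting an integer multiple of an integer matrix. [folklore] -/
private theorem map_intCast_zsmul (m : ℤ) (A : Matrix (Fin 2 ⊕ Fin 2) (Fin 2 ⊕ Fin 2) ℤ) :
    (m • A).map (Int.cast : ℤ → ℝ) = (m : ℝ) • A.map (Int.cast : ℤ → ℝ) := by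
  ext i j; simp only [Matrix.map_apply, Matrix.smul_apply, smul_eq_mul, Int.cast_mul]

/-- `(ᵗR 0; 0 R⁻¹)(ᵗR 0; 0 R⁻¹)⁻¹ = 1` and `(ᵗR 0; 0 R⁻¹)⁻¹(ᵗR 0; 0 R⁻¹) = 1` as real matrices. [folklore] -/
private theorem rungeConj_mul_inv_coe (hΔ : 0 < quadDisc k l) :
    ((rungeConj k l hΔ : Matrix.symplecticGroup (Fin 2) ℝ) : Matrix (Fin 2 ⊕ Fin 2) (Fin 2 ⊕ Fin 2) ℝ) *
        (((rungeConj k l hΔ)⁻¹ : Matrix.symplecticGroup (Fin 2) ℝ) : Matrix (Fin 2 ⊕ Fin 2) (Fin 2 ⊕ Fin 2) ℝ) = 1 ∧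
      (((rungeConj k l hΔ)⁻¹ : Matrix.symplecticGroup (Fin 2) ℝ) : Matrix (Fin 2 ⊕ Fin 2) (Fin 2 ⊕ Fin 2) ℝ) *
        ((rungeConj k l hΔ : Matrix.symplecticGroup (Fin 2) ℝ) : Matrix (Fin 2 ⊕ Fin 2) (Fin 2 ⊕ Fin 2) ℝ) = 1 := by
  constructor
  · rw [← Submonoid.coe_mul, mul_inv_cancel, Submonoid.coe_one]
  · rw [← Submonoid.coe_mul, inv_mul_cancel, Submonoid.coe_one]

/-- **Sign `+`: an integral symplectic `N` with `q₀^N = q₀` acts on `𝔥₂` as the lift of a pair `g ∈ SL₂(ℝ)²`: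
`ᵗN = (ᵗR 0; 0 R⁻¹) σ(g) (ᵗR 0; 0 R⁻¹)⁻¹`.** [cite: Runge1999EndomorphismRingsAbelianSurfaces, §4 p. 291 (Lemma 4)] -/
theorem exists_eq_modularEmbeddingLift_of_humbertVectorConj_eq_self (hΔ : 0 < quadDisc k l)
    {N : Matrix (Fin 2 ⊕ Fin 2) (Fin 2 ⊕ Fin 2) ℤ} (hN : Nᵀ * typeForm (fun _ : Fin 2 ↦ 1) * N = typeForm fun _ : Fin 2 ↦ 1)
    (h : humbertVectorConj N (humbertNormalForm k l) = humbertNormalForm k l) :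
    ∃ g : Fin 2 → Matrix.SpecialLinearGroup (Fin 2) ℝ,
      (⟨toGD (fun _ : Fin 2 ↦ 1) N, toGD_mem principalType_pos hN⟩ : Matrix.symplecticGroup (Fin 2) ℝ) =
        modularEmbeddingLift k l hΔ g := by
  obtain ⟨hQQi, hQiQ⟩ := rungeConj_mul_inv_coe hΔ
  set A : Matrix.symplecticGroup (Fin 2) ℝ := ⟨toGD (fun _ : Fin 2 ↦ 1) N, toGD_mem principalType_pos hN⟩ with hA
  set Q : Matrix.symplecticGroup (Fin 2) ℝ := rungeConj k l hΔ with hQ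
  set F : Matrix (Fin 2 ⊕ Fin 2) (Fin 2 ⊕ Fin 2) ℝ := ((omegaRep k l).map (Int.cast : ℤ → ℝ))ᵀ with hF
  set D : Matrix (Fin 2 ⊕ Fin 2) (Fin 2 ⊕ Fin 2) ℝ := diagonal (Sum.elim (quadRoot k l) (quadRoot k l)) with hD
  -- `a = ᵗn` commutes with `F = ᵗf₀`
  have hcommZ := omegaRep_mul_eq_of_humbertVectorConj_eq_self hN h
  have haF : (A : Matrix (Fin 2 ⊕ Fin 2) (Fin 2 ⊕ Fin 2) ℝ) * F = F * (A : Matrix _ _ ℝ) := by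
    have e := congrArg (fun Y : Matrix (Fin 2 ⊕ Fin 2) (Fin 2 ⊕ Fin 2) ℤ ↦ (Y.map (Int.cast : ℤ → ℝ))ᵀ) hcommZ
    simp only [map_intCast_mul, Matrix.transpose_mul] at e
    show toGD (fun _ : Fin 2 ↦ 1) N * F = F * toGD (fun _ : Fin 2 ↦ 1) N
    rw [toGD_one_eq_transpose, hF]
    exact e
  -- `D = Q⁻¹ F Q`
  have hDQ : (((Q⁻¹ : Matrix.symplecticGroup (Fin 2) ℝ)) : Matrix (Fin 2 ⊕ Fin 2) (Fin 2 ⊕ Fin 2) ℝ) * F *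
      (Q : Matrix (Fin 2 ⊕ Fin 2) (Fin 2 ⊕ Fin 2) ℝ) = D :=
    rungeConj_inv_mul_transpose_omegaRep_mul_rungeConj hΔ
  -- `b = Q⁻¹ a Q` commutes with `D`
  have hcomm : ((Q⁻¹ * A * Q : Matrix.symplecticGroup (Fin 2) ℝ) : Matrix (Fin 2 ⊕ Fin 2) (Fin 2 ⊕ Fin 2) ℝ) * D =
      D * ((Q⁻¹ * A * Q : Matrix.symplecticGroup (Fin 2) ℝ) : Matrix (Fin 2 ⊕ Fin 2) (Fin 2 ⊕ Fin 2) ℝ) := by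
    rw [Submonoid.coe_mul, Submonoid.coe_mul, ← hDQ]
    calc ((Q⁻¹ : Matrix.symplecticGroup (Fin 2) ℝ) : Matrix _ _ ℝ) * (A : Matrix _ _ ℝ) * (Q : Matrix _ _ ℝ) *
          (((Q⁻¹ : Matrix.symplecticGroup (Fin 2) ℝ) : Matrix _ _ ℝ) * F * (Q : Matrix _ _ ℝ))
        = ((Q⁻¹ : Matrix.symplecticGroup (Fin 2) ℝ) : Matrix _ _ ℝ) * (A : Matrix _ _ ℝ) *
            ((Q : Matrix _ _ ℝ) * ((Q⁻¹ : Matrix.symplecticGroup (Fin 2) ℝ) : Matrix _ _ ℝ)) * F * (Q : Matrix _ _ ℝ) := by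
          simp only [Matrix.mul_assoc]
      _ = ((Q⁻¹ : Matrix.symplecticGroup (Fin 2) ℝ) : Matrix _ _ ℝ) * ((A : Matrix _ _ ℝ) * F) * (Q : Matrix _ _ ℝ) := by
          rw [hQQi, Matrix.mul_one]; simp only [Matrix.mul_assoc]
      _ = ((Q⁻¹ : Matrix.symplecticGroup (Fin 2) ℝ) : Matrix _ _ ℝ) * (F * (A : Matrix _ _ ℝ)) * (Q : Matrix _ _ ℝ) := by
          rw [haF]
      _ = ((Q⁻¹ : Matrix.symplecticGroup (Fin 2) ℝ) : Matrix _ _ ℝ) * F *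
            ((Q : Matrix _ _ ℝ) * ((Q⁻¹ : Matrix.symplecticGroup (Fin 2) ℝ) : Matrix _ _ ℝ)) * (A : Matrix _ _ ℝ) * (Q : Matrix _ _ ℝ) := by
          rw [hQQi, Matrix.mul_one]; simp only [Matrix.mul_assoc]
      _ = ((Q⁻¹ : Matrix.symplecticGroup (Fin 2) ℝ) : Matrix _ _ ℝ) * F * (Q : Matrix _ _ ℝ) *
            (((Q⁻¹ : Matrix.symplecticGroup (Fin 2) ℝ) : Matrix _ _ ℝ) * (A : Matrix _ _ ℝ) * (Q : Matrix _ _ ℝ)) := by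
          simp only [Matrix.mul_assoc]
  obtain ⟨g, hg⟩ := exists_eq_slPairSp_of_commute (quadRoot_zero_ne_one hΔ) hcomm
  refine ⟨g, ?_⟩
  rw [modularEmbeddingLift, ← hg, ← hQ]
  group

/-- **Sign `−`: an integral symplectic `N` with `q₀^N = −q₀` acts as `σ_Gal · lift(g)` for a pair `g ∈ SL₂(ℝ)²`.**
[cite: Runge1999EndomorphismRingsAbelianSurfaces, §4 p. 291 (Lemma 4)] -/
theorem exists_eq_swapSp_mul_modularEmbeddingLift_of_humbertVectorConj_eq_neg (hΔ : 0 < quadDisc k l)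
    {N : Matrix (Fin 2 ⊕ Fin 2) (Fin 2 ⊕ Fin 2) ℤ} (hN : Nᵀ * typeForm (fun _ : Fin 2 ↦ 1) * N = typeForm fun _ : Fin 2 ↦ 1)
    (h : humbertVectorConj N (humbertNormalForm k l) = -humbertNormalForm k l) :
    ∃ g : Fin 2 → Matrix.SpecialLinearGroup (Fin 2) ℝ,
      (⟨toGD (fun _ : Fin 2 ↦ 1) N, toGD_mem principalType_pos hN⟩ : Matrix.symplecticGroup (Fin 2) ℝ) =
        swapSp l * modularEmbeddingLift k l hΔ g := by
  obtain ⟨hQQi, hQiQ⟩ := rungeConj_mul_inv_coe hΔ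
  set A : Matrix.symplecticGroup (Fin 2) ℝ := ⟨toGD (fun _ : Fin 2 ↦ 1) N, toGD_mem principalType_pos hN⟩ with hA
  set Q : Matrix.symplecticGroup (Fin 2) ℝ := rungeConj k l hΔ with hQ
  set F : Matrix (Fin 2 ⊕ Fin 2) (Fin 2 ⊕ Fin 2) ℝ := ((omegaRep k l).map (Int.cast : ℤ → ℝ))ᵀ with hF
  set D : Matrix (Fin 2 ⊕ Fin 2) (Fin 2 ⊕ Fin 2) ℝ := diagonal (Sum.elim (quadRoot k l) (quadRoot k l)) with hD
  -- `a F + F a = l a`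
  have hantiZ := omegaRep_mul_eq_of_humbertVectorConj_eq_neg hN h
  have haF : (A : Matrix (Fin 2 ⊕ Fin 2) (Fin 2 ⊕ Fin 2) ℝ) * F + F * (A : Matrix _ _ ℝ) = (l : ℝ) • (A : Matrix _ _ ℝ) := by
    have e := congrArg (fun Y : Matrix (Fin 2 ⊕ Fin 2) (Fin 2 ⊕ Fin 2) ℤ ↦ (Y.map (Int.cast : ℤ → ℝ))ᵀ) hantiZ
    simp only [map_intCast_mul, map_intCast_sub, map_intCast_zsmul, Matrix.transpose_mul, Matrix.transpose_sub,
      Matrix.transpose_smul] at e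
    show toGD (fun _ : Fin 2 ↦ 1) N * F + F * toGD (fun _ : Fin 2 ↦ 1) N = (l : ℝ) • toGD (fun _ : Fin 2 ↦ 1) N
    rw [toGD_one_eq_transpose, hF, e]
    abel
  have hDQ : (((Q⁻¹ : Matrix.symplecticGroup (Fin 2) ℝ)) : Matrix (Fin 2 ⊕ Fin 2) (Fin 2 ⊕ Fin 2) ℝ) * F *
      (Q : Matrix (Fin 2 ⊕ Fin 2) (Fin 2 ⊕ Fin 2) ℝ) = D :=
    rungeConj_inv_mul_transpose_omegaRep_mul_rungeConj hΔ
  have hsum : quadRoot k l 0 + quadRoot k l 1 = l := quadRoot_add k l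
  -- `b D + D b = l b` for `b = Q⁻¹ a Q`
  have hanti : ((Q⁻¹ * A * Q : Matrix.symplecticGroup (Fin 2) ℝ) : Matrix (Fin 2 ⊕ Fin 2) (Fin 2 ⊕ Fin 2) ℝ) * D +
      D * ((Q⁻¹ * A * Q : Matrix.symplecticGroup (Fin 2) ℝ) : Matrix (Fin 2 ⊕ Fin 2) (Fin 2 ⊕ Fin 2) ℝ) =
        (quadRoot k l 0 + quadRoot k l 1) •
          ((Q⁻¹ * A * Q : Matrix.symplecticGroup (Fin 2) ℝ) : Matrix (Fin 2 ⊕ Fin 2) (Fin 2 ⊕ Fin 2) ℝ) := by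
    rw [hsum, Submonoid.coe_mul, Submonoid.coe_mul, ← hDQ]
    have e1 : ((Q⁻¹ : Matrix.symplecticGroup (Fin 2) ℝ) : Matrix _ _ ℝ) * (A : Matrix _ _ ℝ) * (Q : Matrix _ _ ℝ) *
        (((Q⁻¹ : Matrix.symplecticGroup (Fin 2) ℝ) : Matrix _ _ ℝ) * F * (Q : Matrix _ _ ℝ)) =
          ((Q⁻¹ : Matrix.symplecticGroup (Fin 2) ℝ) : Matrix _ _ ℝ) * ((A : Matrix _ _ ℝ) * F) * (Q : Matrix _ _ ℝ) := by
      calc ((Q⁻¹ : Matrix.symplecticGroup (Fin 2) ℝ) : Matrix _ _ ℝ) * (A : Matrix _ _ ℝ) * (Q : Matrix _ _ ℝ) *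
            (((Q⁻¹ : Matrix.symplecticGroup (Fin 2) ℝ) : Matrix _ _ ℝ) * F * (Q : Matrix _ _ ℝ))
          = ((Q⁻¹ : Matrix.symplecticGroup (Fin 2) ℝ) : Matrix _ _ ℝ) * (A : Matrix _ _ ℝ) *
              ((Q : Matrix _ _ ℝ) * ((Q⁻¹ : Matrix.symplecticGroup (Fin 2) ℝ) : Matrix _ _ ℝ)) * F * (Q : Matrix _ _ ℝ) := by
            simp only [Matrix.mul_assoc]
        _ = _ := by rw [hQQi, Matrix.mul_one]; simp only [Matrix.mul_assoc]
    have e2 : ((Q⁻¹ : Matrix.symplecticGroup (Fin 2) ℝ) : Matrix _ _ ℝ) * F * (Q : Matrix _ _ ℝ) *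
        (((Q⁻¹ : Matrix.symplecticGroup (Fin 2) ℝ) : Matrix _ _ ℝ) * (A : Matrix _ _ ℝ) * (Q : Matrix _ _ ℝ)) =
          ((Q⁻¹ : Matrix.symplecticGroup (Fin 2) ℝ) : Matrix _ _ ℝ) * (F * (A : Matrix _ _ ℝ)) * (Q : Matrix _ _ ℝ) := by
      calc ((Q⁻¹ : Matrix.symplecticGroup (Fin 2) ℝ) : Matrix _ _ ℝ) * F * (Q : Matrix _ _ ℝ) *
            (((Q⁻¹ : Matrix.symplecticGroup (Fin 2) ℝ) : Matrix _ _ ℝ) * (A : Matrix _ _ ℝ) * (Q : Matrix _ _ ℝ))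
          = ((Q⁻¹ : Matrix.symplecticGroup (Fin 2) ℝ) : Matrix _ _ ℝ) * F *
              ((Q : Matrix _ _ ℝ) * ((Q⁻¹ : Matrix.symplecticGroup (Fin 2) ℝ) : Matrix _ _ ℝ)) * (A : Matrix _ _ ℝ) * (Q : Matrix _ _ ℝ) := by
            simp only [Matrix.mul_assoc]
        _ = _ := by rw [hQQi, Matrix.mul_one]; simp only [Matrix.mul_assoc]
    rw [e1, e2, ← Matrix.add_mul, ← Matrix.mul_add, haF, Matrix.mul_smul, Matrix.smul_mul]
  obtain ⟨g, hg⟩ := exists_eq_permSp_mul_slPairSp_of_anticommute (quadRoot_zero_ne_one hΔ) hanti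
  refine ⟨g, ?_⟩
  have hA' : A = Q * (permSp * slPairSp g) * Q⁻¹ := by rw [← hg]; group
  rw [hA', modularEmbeddingLift, ← rungeConj_mul_permSp_mul_rungeConj_inv hΔ, ← hQ]
  group

/-- **RUNGE'S LEMMA 4 (as an equality of sets): `γ ∈ Γ((k,l,−1,0,0))` iff `γ = lift(g)` or `γ = σ_Gal · lift(g)` for some
`g ∈ SL(O ⊕ O^∨)`.** [cite: Runge1999EndomorphismRingsAbelianSurfaces, §4 p. 291 (Lemma 4: "The Humbert modular group `Γ(F) = Γ(Δ)` is generated by `σ_Gal` and `ψ_O(Sl(2, O))`")] -/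
theorem mem_humbertModularGroup_humbertNormalForm_iff (hΔ : 0 < quadDisc k l) {A : Matrix.symplecticGroup (Fin 2) ℝ} :
    A ∈ humbertModularGroup (humbertNormalForm k l) ↔
      ∃ g ∈ hilbertModularPairGroup k l hΔ,
        A = modularEmbeddingLift k l hΔ g ∨ A = swapSp l * modularEmbeddingLift k l hΔ g := by
  constructor
  · intro hA
    have hlev := humbertModularGroup_le_levelGD hA
    obtain ⟨N, hN, hNA⟩ := (mem_range_gDHom_one_iff A).1 ((siegelThreefold.mem_levelGD_one_iff principalType_pos).1 hlev)
    have hAeq : A = ⟨toGD (fun _ : Fin 2 ↦ 1) N, toGD_mem principalType_pos hN⟩ := Subtype.ext hNA.symm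
    -- `A⁻¹ = gDHom (spUnit N) ∈ Γ(q₀)` gives `q₀^N = ±q₀`
    have hinv : gDHom (fun _ : Fin 2 ↦ 1) principalType_pos (spUnit N hN) ∈ humbertModularGroup (humbertNormalForm k l) := by
      rw [gDHom_spUnit, ← hAeq]; exact inv_mem hA
    have hpos : 0 < humbertInvariant (humbertNormalForm k l) := by rwa [humbertInvariant_humbertNormalForm]
    rcases ((isPrimitiveRel_humbertNormalForm k l).gDHom_mem_humbertModularGroup_iff hpos (spUnit N hN)).1 hinv with
      hq | hq
    · obtain ⟨g, hg⟩ := exists_eq_modularEmbeddingLift_of_humbertVectorConj_eq_self hΔ hN hq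
      refine ⟨g, ?_, Or.inl (hAeq.trans hg)⟩
      rw [mem_hilbertModularPairGroup_iff_mem_range, ← hg, ← hAeq]
      exact (siegelThreefold.mem_levelGD_one_iff principalType_pos).1 hlev
    · obtain ⟨g, hg⟩ := exists_eq_swapSp_mul_modularEmbeddingLift_of_humbertVectorConj_eq_neg hΔ hN hq
      refine ⟨g, ?_, Or.inr (hAeq.trans hg)⟩
      rw [mem_hilbertModularPairGroup_iff_mem_range]
      have e : modularEmbeddingLift k l hΔ g = swapSp l * A := by
        rw [hAeq, hg, ← mul_assoc, swapSp_mul_self, one_mul]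
      rw [e]
      exact mul_mem ((siegelThreefold.mem_levelGD_one_iff principalType_pos).1 (swapSp_mem_levelGD l))
        ((siegelThreefold.mem_levelGD_one_iff principalType_pos).1 hlev)
  · rintro ⟨g, hg, rfl | rfl⟩
    · exact modularEmbeddingLift_mem_humbertModularGroup_of_mem hΔ hg
    · exact mul_mem (swapSp_mem_humbertModularGroup hΔ) (modularEmbeddingLift_mem_humbertModularGroup_of_mem hΔ hg)

/-- **RUNGE'S LEMMA 4 (as printed): "The Humbert modular group `Γ(F) = Γ(Δ)` is generated by `σ_Gal` and
`ψ_O(Sl(2, O))`"** — `Γ((k,l,−1,0,0))` is the subgroup of `Sp₄(ℝ)` generated by `σ_Gal = swapSp l` and the lifts of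
`SL(O ⊕ O^∨)`. [cite: Runge1999EndomorphismRingsAbelianSurfaces, §4 p. 291 (Lemma 4)] -/
theorem humbertModularGroup_humbertNormalForm_eq_closure (hΔ : 0 < quadDisc k l) :
    humbertModularGroup (humbertNormalForm k l) =
      Subgroup.closure (insert (swapSp l) (modularEmbeddingLift k l hΔ '' (hilbertModularPairGroup k l hΔ : Set _))) := by
  apply le_antisymm
  · intro A hA
    obtain ⟨g, hg, rfl | rfl⟩ := (mem_humbertModularGroup_humbertNormalForm_iff hΔ).1 hA
    · exact Subgroup.subset_closure (Set.mem_insert_of_mem _ ⟨g, hg, rfl⟩)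
    · exact mul_mem (Subgroup.subset_closure (Set.mem_insert _ _))
        (Subgroup.subset_closure (Set.mem_insert_of_mem _ ⟨g, hg, rfl⟩))
  · rw [Subgroup.closure_le]
    rintro A (rfl | ⟨g, hg, rfl⟩)
    · exact swapSp_mem_humbertModularGroup hΔ
    · exact modularEmbeddingLift_mem_humbertModularGroup_of_mem hΔ hg

/-- The same with the lifted subgroup: `Γ(Δ) = lift(SL(O ⊕ O^∨)) ⊔ ⟨σ_Gal⟩`. [cite: Runge1999EndomorphismRingsAbelianSurfaces, §4 p. 291 (Lemma 4)] -/
theorem humbertModularGroup_humbertNormalForm_eq_sup (hΔ : 0 < quadDisc k l) :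
    humbertModularGroup (humbertNormalForm k l) =
      (hilbertModularPairGroup k l hΔ).map (modularEmbeddingLiftHom k l hΔ) ⊔ Subgroup.zpowers (swapSp l) := by
  apply le_antisymm
  · intro A hA
    obtain ⟨g, hg, rfl | rfl⟩ := (mem_humbertModularGroup_humbertNormalForm_iff hΔ).1 hA
    · exact Subgroup.mem_sup_left ⟨g, hg, rfl⟩
    · exact mul_mem (Subgroup.mem_sup_right (Subgroup.mem_zpowers _)) (Subgroup.mem_sup_left ⟨g, hg, rfl⟩)
  · rw [sup_le_iff]
    constructor
    · rintro _ ⟨g, hg, rfl⟩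
      exact modularEmbeddingLift_mem_humbertModularGroup_of_mem hΔ hg
    · rw [Subgroup.zpowers_le]
      exact swapSp_mem_humbertModularGroup hΔ

/-- **The pull-back to `ℍ × ℍ` (Elkies–Kumar: "the induced map on `(Γ ∪ Γσ)\ℍ²` is generically one to one"): if
`τ ∈ ℍ × ℍ` has relation lattice `ℤ · (k,l,−1,0,0)` and `[π[R](τ)] = [π[R](τ′)]` in `𝒜₂ = Sp₄(ℤ)\𝔥₂`, then
`τ′ = g · τ` or `τ′ = g · τ^σ` for some `g ∈ SL(O ⊕ O^∨)`, `τ^σ = (τ₂, τ₁)`.**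
[cite: ElkiesKumar2014HilbertModularSurfaces, §4] [cite: Runge1999EndomorphismRingsAbelianSurfaces, §3 p. 287 and §4 p. 291] -/
theorem exists_mem_hilbertModularPairGroup_of_mk_modularEmbedding_eq (hΔ : 0 < quadDisc k l) {τ τ' : Fin 2 → ℍ}
    (hgen : ∀ q' : Fin 5 → ℤ, singularRelation (fun i ↦ (q' i : ℂ))
      (modularEmbedding k l hΔ τ : Matrix (Fin 2) (Fin 2) ℂ) = 0 → ∃ m : ℤ, q' = m • humbertNormalForm k l)
    (h : siegelThreefold.mk (modularEmbedding k l hΔ τ) = siegelThreefold.mk (modularEmbedding k l hΔ τ')) :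
    ∃ g ∈ hilbertModularPairGroup k l hΔ,
      τ' = (fun s ↦ g s • τ s) ∨ τ' = (fun s ↦ g s • τ (Equiv.swap (0 : Fin 2) 1 s)) := by
  obtain ⟨A, hA, hAτ⟩ := exists_mem_humbertModularGroup_smul_modularEmbedding_eq hΔ hgen h
  obtain ⟨g, hg, rfl | rfl⟩ := (mem_humbertModularGroup_humbertNormalForm_iff hΔ).1 hA
  · refine ⟨g, hg, Or.inl ((modularEmbedding_injective hΔ) ?_)⟩
    rw [modularEmbedding_smul, hAτ]
  · refine ⟨fun s ↦ g (Equiv.swap (0 : Fin 2) 1 s), swap_mem_hilbertModularPairGroup hΔ hg,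
      Or.inr ((modularEmbedding_injective hΔ) ?_)⟩
    show modularEmbedding k l hΔ τ' = modularEmbedding k l hΔ ((fun s ↦ g s • τ s) ∘ ⇑(Equiv.swap (0 : Fin 2) 1))
    rw [modularEmbedding_swap_eq_smul, modularEmbedding_smul, ← mul_smul, hAτ]

end Lemma4

end SiegelModuli

end Literature.AlgebraicGeometry.ModuliOfAbelianVarieties
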